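import Summits.QuantumFields.BalabanUV.Beta.RemainderExplicitCarrierSpaces
import Summits.QuantumFields.BalabanUV.Beta.RemainderExplicitCarrierGeometry

/-!
# Beta / RemainderExplicitCarrierColumn — BINDER-OWNERS row D4, ROAD P3 (co-owner #3, unit `b2b-balaban-beta-d4-p3`), skeleton leaves E1/E3.4:
# THE RESTRICTED TEST CONFIGURATION (the periodised Bałaban-normalised column truncated to the one-block collar of a localization domain)
# AS AN ELEMENT OF THE (3.14)/(4.4)-TYPE SPACE, AND ITS NORM BOUND `‖col‖ ≤ C₁e^{κ₁}·e^{−(κ₁/4)·distCT(x, X)}` — uniform in level and volume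

HONEST FRAMING (page 1 of everything the β sub-cell writes): discharging `BetaPertH` makes Bałaban's UV stability
UNCONDITIONAL — a real constructive-QFT result; it is NOT the continuum limit and NOT the Clay problem.  HONEST DEPENDENCY
(verbatim): «continuum YM on T⁴ ⇐ BetaPertH ∧ nine spine estimates (0/9 proved); BetaPertH ⇐ (D1) ∧ (D4) ∧ CAP+tail;
G-an2-4 gates asym, D1 and NE2/3/4.»  NOT IN PRINT; OUR BOOKKEEPING.  `[folklore]` assembly of `RemainderExplicitTorusBounds.exists_hTor_bounds`
(the four components on the torus), `RemainderExplicitCarrierGeometry` (collar, distance comparison, periodicities) and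
`RemainderExplicitCarrierSpaces.norm_le_of_components`.  No cited fact, no wall binder, no `def … : Prop`.  NOT summit progress.

ABSOLUTE RULE (cell charter, verbatim): "No internally-minted statement may enter as a cited fact. Every hypothesis is
either kernel-proved in this package or a verbatim quotation of a PUBLISHED theorem with page reference. The manuscript(s)
under audit are NOT citable for their own disputed steps — they are the thing under adjudication; programme-internal
(2001/route/tribunal) claims are never citable."
-/

noncomputable section

open Finset Filter
open scoped BigOperators
open Literature.Probability.LatticeModels (TorusSite)
open Literature.MathematicalPhysics.QuantumFieldTheory.LatticeForm (quo)
open Literature.MathematicalPhysics.QuantumFieldTheory.Balaban1983to89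
open Literature.MathematicalPhysics.QuantumFieldTheory.Balaban1983to89.Beta
open Literature.MathematicalPhysics.QuantumFieldTheory.Balaban1983to89.TreeLengthTorus (TPt TDom proj natLift proj_natLift)
open B12Decay510Torus (tcubeOf distCT distCT_nonneg nearT)
open AffineAveraging (Site Form1 unitVec unitVec_apply dz codiff₁)
open B4TorusKernel.MultiPeriod (torusSupNorm)
open Summit.QuantumFields.BalabanUV.Beta.RemainderExplicitUnits (side side_pos)
open Summit.QuantumFields.BalabanUV.Beta.RemainderExplicitSecondOrder (lapVec)
open Summit.QuantumFields.BalabanUV.Beta.RemainderExplicitTorusBounds (hTor exists_hTor_bounds)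
open Summit.QuantumFields.BalabanUV.Beta.RemainderExplicitCarrierSpaces (lapVecC ext RCfg val norm_le_of_components)
open Summit.QuantumFields.BalabanUV.Beta.RemainderExplicitCarrierGeometry (usite collar usite_add_mem_collar distCT_nearT_le
  hTor_natLift_proj)

namespace Summit.QuantumFields.BalabanUV.Beta.RemainderExplicitCarrierColumn

variable (Lc : ℕ) [NeZero Lc] (j : ℕ) {Nn Mc : ℕ} [NeZero Nn] [NeZero Mc]

/-! ## §1 The truncated periodised column on the fine torus -/

/-- The fine torus of volume index with unit side `Nn·Mc` at level `j` has `Lc^{j+1}·(Nn·Mc)` sites per direction. [folklore] -/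
instance instNeZeroFine : NeZero (Lc ^ (j + 1) * (Nn * Mc)) :=
  ⟨mul_ne_zero (pow_ne_zero _ (NeZero.ne Lc)) (mul_ne_zero (NeZero.ne Nn) (NeZero.ne Mc))⟩

/-- The block side as an instance. [folklore] -/
instance instNeZeroBlock : NeZero (Lc ^ (j + 1)) := ⟨pow_ne_zero _ (NeZero.ne Lc)⟩

/-- THE FINE SITES OVER A LOCALIZATION DOMAIN `X` (cubes of the unit torus): the fine torus sites whose block's cube lies in `X`. [folklore] -/
def fineOver (X : TDom 4 Nn) : Finset (TPt 4 (Lc ^ (j + 1) * (Nn * Mc))) :=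
  Finset.univ.filter fun zf => tcubeOf Nn Mc (usite (Mc := Mc) (Lc ^ (j + 1)) (natLift zf)) ∈ X.1

/-- Membership in `fineOver`. [folklore] -/
theorem mem_fineOver {X : TDom 4 Nn} {zf : TPt 4 (Lc ^ (j + 1) * (Nn * Mc))} :
    zf ∈ fineOver Lc j X ↔ tcubeOf Nn Mc (usite (Mc := Mc) (Lc ^ (j + 1)) (natLift zf)) ∈ X.1 := by
  simp [fineOver]

/-- **THE TRUNCATED COLUMN** (values): the periodised, Bałaban-normalised test configuration for the source bond `(μ, x)`, kept on the
fine sites whose block lies in the one-block collar of `X` and set to `0` elsewhere. [folklore] -/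
def colVal (X : TDom 4 Nn) (μ : Fin 4) (x : TPt 4 (Nn * Mc)) : Fin 4 × TPt 4 (Lc ^ (j + 1) * (Nn * Mc)) → ℂ :=
  fun i => if usite (Mc := Mc) (Lc ^ (j + 1)) (natLift i.2) ∈ collar (Mc := Mc) X
    then ((hTor Lc j (fun _ => Nn * Mc) μ (natLift x) i.1 (natLift i.2) : ℝ) : ℂ) else 0

/-- [folklore] The periodic extension of the truncated column, unfolded. -/
theorem ext_colVal (X : TDom 4 Nn) (μ : Fin 4) (x : TPt 4 (Nn * Mc)) (κ : Fin 4) (w : Site 4) :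
    ext (colVal Lc j X μ x) κ w
      = if usite (Mc := Mc) (Lc ^ (j + 1)) (natLift (proj (Lc ^ (j + 1) * (Nn * Mc)) w)) ∈ collar (Mc := Mc) X
        then ((hTor Lc j (fun _ => Nn * Mc) μ (natLift x) κ (natLift (proj (Lc ^ (j + 1) * (Nn * Mc)) w)) : ℝ) : ℂ) else 0 := rfl

/-- **THE RESTRICTED TEST CONFIGURATION** as an element of the (3.14)/(4.4)-type space of the domain `X`. [folklore] -/
def col (X : TDom 4 Nn) (μ : Fin 4) (x : TPt 4 (Nn * Mc)) : RCfg (Lc ^ (j + 1) * (Nn * Mc)) (side Lc j) (fineOver Lc j (Mc := Mc) X) :=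
  colVal Lc j X μ x

/-- [folklore] `val (col …) = colVal …`. -/
theorem val_col (X : TDom 4 Nn) (μ : Fin 4) (x : TPt 4 (Nn * Mc)) : val (col Lc j X μ x) = colVal Lc j X μ x := rfl

/-! ## §2 Near a fine point over `X` the truncated column IS the periodised column -/

/-- [folklore] A point is within one step per coordinate of itself. -/
theorem near1_self (w : Site 4) : ∀ i, |w i - w i| ≤ 1 := fun i => by simp

/-- [folklore] `w + e_ν` is within one step per coordinate of `w`. -/
theorem near1_add_unitVec (w : Site 4) (ν : Fin 4) : ∀ i, |(w + unitVec ν) i - w i| ≤ 1 := fun i => by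
  simp only [Pi.add_apply, unitVec_apply]; split_ifs <;> simp

/-- [folklore] `w − e_ν` is within one step per coordinate of `w`. -/
theorem near1_sub_unitVec (w : Site 4) (ν : Fin 4) : ∀ i, |(w - unitVec ν) i - w i| ≤ 1 := fun i => by
  simp only [Pi.sub_apply, unitVec_apply]; split_ifs <;> simp

/-- [folklore] `w + e_ν − e_κ` is within one step per coordinate of `w`. -/
theorem near1_add_sub_unitVec (w : Site 4) (ν κ : Fin 4) : ∀ i, |(w + unitVec ν - unitVec κ) i - w i| ≤ 1 := fun i => by
  simp only [Pi.add_apply, Pi.sub_apply, unitVec_apply]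
  split_ifs <;> simp

/-- [folklore] The block of the canonical lift of the class of `w` on the fine torus is the block of `w`. -/
theorem usite_natLift_proj (w : Site 4) :
    usite (Mc := Mc) (Lc ^ (j + 1)) (natLift (proj (Lc ^ (j + 1) * (Nn * Mc)) w)) = usite (Nn := Nn) (Mc := Mc) (Lc ^ (j + 1)) w := by
  obtain ⟨k, hk⟩ := RemainderExplicitCarrierGeometry.exists_natLift_proj_eq (Lc ^ (j + 1) * (Nn * Mc)) w
  rw [hk]
  unfold usite
  have : (fun ν => (((Lc ^ (j + 1) * (Nn * Mc) : ℕ) : ℤ)) * k ν) = ((Lc ^ (j + 1) : ℕ) : ℤ) • (fun ν => ((Nn * Mc : ℕ) : ℤ) * k ν) := by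
    funext ν; simp; ring
  rw [this, BlochFibreUniqueness.quo_add_zsmul]
  funext i
  simp only [proj, Pi.add_apply, Int.cast_add, Int.cast_mul, Int.cast_natCast, ZMod.natCast_self, zero_mul, add_zero]

/-- [folklore] **THE TRUNCATION IS INVISIBLE FROM `X̃`**: at every point within one step per coordinate of a fine point over `X`, the periodic
extension of the truncated column equals the periodised column `hTor`. -/
theorem ext_colVal_eq {X : TDom 4 Nn} {zf : TPt 4 (Lc ^ (j + 1) * (Nn * Mc))} (hzf : zf ∈ fineOver Lc j (Mc := Mc) X)
    (μ : Fin 4) (x : TPt 4 (Nn * Mc)) (κ : Fin 4) {w : Site 4} (hw : ∀ i, |w i - natLift zf i| ≤ 1) :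
    ext (colVal Lc j X μ x) κ w = ((hTor Lc j (fun _ => Nn * Mc) μ (natLift x) κ w : ℝ) : ℂ) := by
  have hX := (mem_fineOver Lc j).1 hzf
  have hwe : w = natLift zf + (w - natLift zf) := by abel
  have hmem : usite (Mc := Mc) (Lc ^ (j + 1)) w ∈ collar (Mc := Mc) X := by
    rw [hwe]; exact usite_add_mem_collar (Lc ^ (j + 1)) hX (w - natLift zf) (fun i => hw i)
  rw [ext_colVal, usite_natLift_proj, if_pos hmem, hTor_natLift_proj]

/-! ## §3 The norm bound of the restricted test configuration -/

/-- [folklore] **THE RESTRICTED TEST CONFIGURATION IN THE (3.14)/(4.4)-TYPE NORM DECAYS WITH THE DISTANCE OF THE SOURCE FROM THE DOMAIN**,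
uniformly in the level `j`, the volume `Nn` and the domain: ONE `(δ₀, B₃)` with `‖col j X μ x‖ ≤ B₃·e^{−δ₀·distCT x (nearT x X)}`. -/
theorem exists_norm_col_le :
    ∃ δ₀ B₃ : ℝ, 0 < δ₀ ∧ 0 ≤ B₃ ∧ ∀ (j : ℕ) (Nn Mc : ℕ) [NeZero Nn] [NeZero Mc] (X : TDom 4 Nn) (μ : Fin 4) (x : TPt 4 (Nn * Mc)),
      ‖col Lc j (Mc := Mc) X μ x‖ ≤ B₃ * Real.exp (-δ₀ * distCT Nn Mc x (nearT (M := Mc) x X)) := by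
  obtain ⟨κ₁, C₁, hκ₁, hC₁, hb⟩ := exists_hTor_bounds (Lc := Lc)
  refine ⟨κ₁ / 4, C₁ * Real.exp κ₁, by positivity, by positivity, ?_⟩
  intro j Nn Mc _ _ X μ x
  haveI : ∀ ν : Fin 4, NeZero ((fun _ : Fin 4 => Nn * Mc) ν) := fun _ => ⟨mul_ne_zero (NeZero.ne Nn) (NeZero.ne Mc)⟩
  have hB0 : 0 ≤ C₁ * Real.exp κ₁ * Real.exp (-(κ₁ / 4) * distCT Nn Mc x (nearT (M := Mc) x X)) := by positivity
  -- the key comparison: a collar block's torus distance controls the chain's distance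
  have key : ∀ w : Site 4, usite (Mc := Mc) (Lc ^ (j + 1)) w ∈ collar (Mc := Mc) X →
      C₁ * Real.exp (-(κ₁ * torusSupNorm (fun _ : Fin 4 => Nn * Mc) (quo (Lc ^ (j + 1)) w - natLift x)))
        ≤ C₁ * Real.exp κ₁ * Real.exp (-(κ₁ / 4) * distCT Nn Mc x (nearT (M := Mc) x X)) := by
    intro w hw
    have hcmp := distCT_nearT_le (Nn := Nn) (Mc := Mc) (Lc ^ (j + 1)) hw x
    rw [mul_assoc, ← Real.exp_add]
    refine mul_le_mul_of_nonneg_left (Real.exp_le_exp.2 ?_) hC₁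
    nlinarith
  -- interior points of the window have their block in the collar
  have hin : ∀ {zf : TPt 4 (Lc ^ (j + 1) * (Nn * Mc))}, zf ∈ fineOver Lc j (Mc := Mc) X →
      usite (Mc := Mc) (Lc ^ (j + 1)) (natLift zf) ∈ collar (Mc := Mc) X := by
    intro zf hzf
    have h := usite_add_mem_collar (Lc ^ (j + 1)) ((mem_fineOver Lc j).1 hzf) 0 (fun i => by simp)
    rwa [add_zero] at h
  refine norm_le_of_components (col Lc j X μ x) hB0 ?_ ?_ ?_ ?_
  · -- |A| everywhere
    intro κ zf
    rw [val_col]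
    simp only [colVal]
    split_ifs with h
    · rw [Complex.norm_real, Real.norm_eq_abs]
      exact ((hb j (fun _ => Nn * Mc) μ (natLift x) κ κ (natLift zf)).1).trans (key _ h)
    · rw [norm_zero]; exact hB0
  · -- s·|∇A| on the window
    intro ν κ zf hzf
    rw [val_col, ext_colVal_eq Lc j hzf μ x κ (near1_add_unitVec _ ν), ext_colVal_eq Lc j hzf μ x κ (near1_self _),
      ← Complex.ofReal_sub, ← Complex.ofReal_mul, Complex.norm_real, Real.norm_eq_abs, abs_mul, abs_of_pos (side_pos j)]
    exact ((hb j (fun _ => Nn * Mc) μ (natLift x) κ ν (natLift zf)).2.1).trans (key _ (hin hzf))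
  · -- s²·|Δ_vec A| on the window
    intro ν zf hzf
    have e : lapVecC (ext (val (col Lc j X μ x))) ν (natLift zf)
        = ((lapVec (hTor Lc j (fun _ => Nn * Mc) μ (natLift x)) ν (natLift zf) : ℝ) : ℂ) := by
      rw [val_col]
      simp only [lapVecC, lapVec, Complex.ofReal_sum, Complex.ofReal_sub, Complex.ofReal_mul, Complex.ofReal_ofNat]
      refine Finset.sum_congr rfl fun μ' _ => ?_
      rw [ext_colVal_eq Lc j hzf μ x ν (near1_self _), ext_colVal_eq Lc j hzf μ x ν (near1_add_unitVec _ μ'),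
        ext_colVal_eq Lc j hzf μ x ν (near1_sub_unitVec _ μ')]
    rw [e, ← Complex.ofReal_pow, ← Complex.ofReal_mul, Complex.norm_real, Real.norm_eq_abs, abs_mul,
      abs_of_pos (pow_pos (side_pos j) 2)]
    exact ((hb j (fun _ => Nn * Mc) μ (natLift x) ν ν (natLift zf)).2.2.1).trans (key _ (hin hzf))
  · -- s²·|d d* A| on the window
    intro ν zf hzf
    have e : dz (codiff₁ (ext (val (col Lc j X μ x)))) ν (natLift zf)
        = ((dz (codiff₁ (hTor Lc j (fun _ => Nn * Mc) μ (natLift x))) ν (natLift zf) : ℝ) : ℂ) := by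
      rw [val_col]
      simp only [dz, codiff₁, Complex.ofReal_sum, Complex.ofReal_sub]
      rw [← Finset.sum_sub_distrib, ← Finset.sum_sub_distrib]
      refine Finset.sum_congr rfl fun κ' _ => ?_
      rw [ext_colVal_eq Lc j hzf μ x κ' (near1_add_sub_unitVec _ ν κ'), ext_colVal_eq Lc j hzf μ x κ' (near1_add_unitVec _ ν),
        ext_colVal_eq Lc j hzf μ x κ' (near1_sub_unitVec _ κ'), ext_colVal_eq Lc j hzf μ x κ' (near1_self _)]
    rw [e, ← Complex.ofReal_pow, ← Complex.ofReal_mul, Complex.norm_real, Real.norm_eq_abs, abs_mul,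
      abs_of_pos (pow_pos (side_pos j) 2)]
    exact ((hb j (fun _ => Nn * Mc) μ (natLift x) ν ν (natLift zf)).2.2.2).trans (key _ (hin hzf))

end Summit.QuantumFields.BalabanUV.Beta.RemainderExplicitCarrierColumn

end
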